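import Summits.SmoothPoincare4.SmoothPoincare4.Theses.CongruenceShadows
import Summits.SmoothPoincare4.SmoothPoincare4.Theorems.WaldhausenPairs.Negative.LoadBearing
import Literature.Topology.FourManifolds.SphereTrisections
import Literature.Topology.FourManifolds.TrisectionFunctorGKGenusZero
import Literature.Topology.FourManifolds.SurfaceGroupGenusOne

/-!
# `AgkCor6Sufficiency` — negative-side support I: tightness of AGK's hypothesis

Support lemmas for the crux `Summit.SmoothPoincare4.SmoothPoincare4.Theses.CongruenceShadows.AgkCor6Sufficiency`
(= `…Theses.GroupTrisection.AgkCor6Sufficiency`, item `stmt-SmoothPoincare4-10894`), extracted from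
the standing disprover's work file `Cruxes/AgkCor6Sufficiency/Disproof.lean` (§2–§4).  The crux is
`X → SmoothPoincare4` with `X` = Abrams–Gay–Kirby's Cor. 6 condition "every `(3k, k)` group
trisection of the trivial group is stably trivial"; nothing here concludes the crux or `X`.

* §1 bookkeeping: `isGroupTrisection_stabilizeIter` (an `n`-fold stabilisation of a `(g,k)`
  trisection of `G` is a `(g+3n, k+n)` trisection of `G`), `isGroupTrisection_cast`,
  `Iso.nonempty_pairQuotient_equiv` /
  `Iso.nonempty_tripleQuotient_equiv` (an isomorphism of kernel triples induces isomorphisms of all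
  vertex groups of the cube); rank invariance `IsFreeOfRank.rank_eq` and the type of the standard
  family `stabilizeIter_isGroupTrisection` are REUSED from `WaldhausenPairs/Negative/LoadBearing.lean`.
* §2 **tightness** `isStablyTrivial_tight`: a stably trivial `(g,k)` group trisection of `G` has
  `g = 3k` and `G ≅ 1` (Euler characteristic and `π₁` are stabilisation invariants) — the family
  `(3k, k, {1})` of AGK Cor. 6 is exactly where stable triviality can hold.
* §3 non-vacuity: `trivialKernels_isStablyTrivial` (via `trivialKernels_stabilize` of
  `SphereTrisections.lean`; with `TrisectionKernels.eq_trivialKernels` the route item `GenusZero` is a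
  two-liner), `agkHypothesis_domain_inhabited` (every `k` carries a stably trivial `(3k,k)` triple).
* §4 a small-model toolkit for explicit kernel triples (`subsingleton_quotient_of_forall_of_mem`,
  `isFreeOfRank_pairQuotient_symm`, `isFreeOfRank_quotient_normalClosure_iff`), used by the
  companion files `UnbalancedFalse.lean` (ℂP²) and `AnyGroupFalse.lean` (`S¹ × S³ # ℂP² # ℂP²`).

References: A. Abrams, D. Gay, R. Kirby, *Group trisections and smooth 4-manifolds*, Geom. Topol.
22 (2018), Def. 1–3, Thm. 5, Cor. 6 (p. 1541); D. Gay, R. Kirby, *Trisecting 4-manifolds*, Geom.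
Topol. 20 (2016), §2 (genus-one trisections of `ℂP²`, `S¹ × S³`; connected sums).
-/

noncomputable section

namespace Summit.SmoothPoincare4.SmoothPoincare4.Theorems.AgkCor6Sufficiency.Negative

open Literature.Topology.FourManifolds Subgroup
/-! ## 1. Bookkeeping: type of stabilisations, transport, invariance under `Iso` -/

section Bookkeeping

variable {g : ℕ}

/-- Iterated stabilisation of a `(g,k)` trisection of `G` is a `(g+3n, k+n)` trisection of `G`. [folklore] -/
theorem isGroupTrisection_stabilizeIter {k : ℕ} {G : Type} [Group G] {K : TrisectionKernels g}
    (hK : IsGroupTrisection g k G K) :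
    ∀ n : ℕ, IsGroupTrisection (g + 3 * n) (k + n) G (K.stabilizeIter n)
  | 0 => hK
  | n + 1 => stabilize_isGroupTrisection_holds _ _ G _ (isGroupTrisection_stabilizeIter hK n)

/-- Transport along an equality of genera preserves the trisection property. [folklore] -/
theorem isGroupTrisection_cast {g' k : ℕ} {G : Type*} [Group G] {K : TrisectionKernels g}
    (hK : IsGroupTrisection g k G K) (h : g = g') : IsGroupTrisection g' k G (K.cast h) := by
  subst h
  exact hK

/-- An isomorphism of kernel triples induces isomorphisms of the pairwise quotients. [folklore] -/
theorem Iso.nonempty_pairQuotient_equiv {K K' : TrisectionKernels g} (h : K.Iso K') (i j : Fin 3) :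
    Nonempty (K.pairQuotient i j ≃* K'.pairQuotient i j) := by
  obtain ⟨α, hα⟩ := h
  have hs : ∀ l, (⇑α) '' (K l : Set (SurfaceGroup g)) = K' l := fun l => by
    rw [← hα l, coe_map]; rfl
  refine ⟨QuotientGroup.congr _ _ α ?_⟩
  rw [map_normalClosure _ _ (show Function.Surjective (α : SurfaceGroup g →* SurfaceGroup g) from
    α.surjective), Set.image_union]
  simp only [MonoidHom.coe_coe, hs]

/-- An isomorphism of kernel triples induces an isomorphism of the triple quotients. [folklore] -/
theorem Iso.nonempty_tripleQuotient_equiv {K K' : TrisectionKernels g} (h : K.Iso K') :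
    Nonempty (K.tripleQuotient ≃* K'.tripleQuotient) := by
  obtain ⟨α, hα⟩ := h
  have hs : ∀ l, (⇑α) '' (K l : Set (SurfaceGroup g)) = K' l := fun l => by
    rw [← hα l, coe_map]; rfl
  refine ⟨QuotientGroup.congr _ _ α ?_⟩
  rw [map_normalClosure _ _ (show Function.Surjective (α : SurfaceGroup g →* SurfaceGroup g) from
    α.surjective), Set.image_iUnion]
  simp only [MonoidHom.coe_coe, hs]

end Bookkeeping

/-! ## 2. Tightness: stable triviality forces AGK's numerics `g = 3k`, `G = 1` -/

/-- **Tightness of the `(3k, k, {1})` family.**  If a `(g,k)` group trisection `K` of `G` is stably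
trivial then `g = 3k` and `G` is trivial: the hypothesis family of AGK Cor. 6 is exactly the family
on which stable triviality is possible. [folklore] -/
theorem isStablyTrivial_tight {g k : ℕ} {G : Type} [Group G] {K : TrisectionKernels g}
    (hK : IsGroupTrisection g k G K) (hst : K.IsStablyTrivial) :
    g = 3 * k ∧ Nonempty (G ≃* PUnit.{1}) := by
  obtain ⟨n, m, h, hiso⟩ := hst
  have h₁ := isGroupTrisection_stabilizeIter hK n
  have h₂ := isGroupTrisection_cast
    (Summit.SmoothPoincare4.SmoothPoincare4.Theorems.WaldhausenPairs.Negative.stabilizeIter_isGroupTrisection m) h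
  obtain ⟨e⟩ := Iso.nonempty_pairQuotient_equiv hiso 0 1
  have hk : k + n = m + 1 :=
    Summit.SmoothPoincare4.SmoothPoincare4.Theorems.WaldhausenPairs.Negative.IsFreeOfRank.rank_eq
      ((h₁.free_pairQuotient 0 1 (by decide)).of_mulEquiv e)
      (h₂.free_pairQuotient 0 1 (by decide))
  obtain ⟨t⟩ := Iso.nonempty_tripleQuotient_equiv hiso
  obtain ⟨eG⟩ := h₁.triple
  obtain ⟨e1⟩ := h₂.triple
  exact ⟨by omega, ⟨eG.symm.trans (t.trans e1)⟩⟩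


/-! ## 3. Non-vacuity: the domain of AGK's hypothesis is inhabited at every `k`, by stably trivial triples -/

/-- Transport does not change stable triviality. [folklore] -/
theorem isStablyTrivial_cast_iff {g g' : ℕ} (K : TrisectionKernels g) (h : g = g') :
    (K.cast h).IsStablyTrivial ↔ K.IsStablyTrivial := by
  subst h
  rfl

/-- The standard family is stably trivial with no stabilisation at all. [folklore] -/
theorem isStablyTrivial_s4Kernels_stabilizeIter (m : ℕ) : (s4Kernels.stabilizeIter m).IsStablyTrivial :=
  ⟨0, m, rfl, TrisectionKernels.Iso.refl _⟩

/-- The `(0,0)` trisection of the trivial group is stably trivial: one stabilisation gives the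
genus-`3` `S⁴` triple on the nose (`3 + 3·0 = 0 + 3·1` by `rfl`). [folklore] -/
theorem trivialKernels_isStablyTrivial : trivialKernels.IsStablyTrivial :=
  ⟨1, 0, rfl, by
    show TrisectionKernels.Iso trivialKernels.stabilize s4Kernels
    rw [trivialKernels_stabilize]
    exact TrisectionKernels.Iso.refl _⟩


/-- For every `k` there is a `(3k, k)` group trisection of `{1}` which IS stably trivial (the
`(0,0)` one for `k = 0`, the transported standard `(3+3m, 1+m)` one for `k = m + 1`): the hypothesis
`X` quantifies over an inhabited family and cannot be refuted inside the standard family. [folklore] -/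
theorem agkHypothesis_domain_inhabited (k : ℕ) :
    ∃ K : TrisectionKernels (3 * k), IsGroupTrisection (3 * k) k (PUnit : Type) K ∧ K.IsStablyTrivial := by
  cases k with
  | zero => exact ⟨trivialKernels, GroupTrisection.trivial.isGroupTrisection, trivialKernels_isStablyTrivial⟩
  | succ m =>
    exact ⟨(s4Kernels.stabilizeIter m).cast (by ring),
      isGroupTrisection_cast
        (Summit.SmoothPoincare4.SmoothPoincare4.Theorems.WaldhausenPairs.Negative.stabilizeIter_isGroupTrisection
          m) _,
      (isStablyTrivial_cast_iff _ _).2 (isStablyTrivial_s4Kernels_stabilizeIter m)⟩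

/-! ## 4. Small-model toolkit for explicit kernel triples -/

section Toolkit

variable {g : ℕ}

/-- A quotient of `S_g` by a normal subgroup containing every generator is trivial. [folklore] -/
theorem subsingleton_quotient_of_forall_of_mem (N : Subgroup (SurfaceGroup g)) [N.Normal]
    (h : ∀ x : surfaceGen g, (PresentedGroup.of x : SurfaceGroup g) ∈ N) :
    Subsingleton (SurfaceGroup g ⧸ N) := by
  refine ⟨fun x y => ?_⟩
  obtain ⟨x, rfl⟩ := QuotientGroup.mk_surjective x
  obtain ⟨y, rfl⟩ := QuotientGroup.mk_surjective y
  exact QuotientGroup.eq.2 (PresentedGroup.generated_by _ N h _)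

/-- Symmetry of the pairwise quotient in `i, j`. [folklore] -/
theorem isFreeOfRank_pairQuotient_symm {K : TrisectionKernels g} {i j : Fin 3} {k : ℕ}
    (h : IsFreeOfRank (K.pairQuotient i j) k) : IsFreeOfRank (K.pairQuotient j i) k :=
  h.of_mulEquiv (QuotientGroup.quotientMulEquivOfEq (by rw [Set.union_comm]))

/-- `free_quotient` asks for the quotient by `normalClosure ↑(K i)`; for normal `K i` this is the
quotient by `K i`. [folklore] -/
theorem isFreeOfRank_quotient_normalClosure_iff (N : Subgroup (SurfaceGroup g)) [N.Normal] (n : ℕ) :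
    IsFreeOfRank (SurfaceGroup g ⧸ normalClosure (N : Set (SurfaceGroup g))) n ↔
      IsFreeOfRank (SurfaceGroup g ⧸ N) n :=
  ⟨fun h => h.of_mulEquiv (QuotientGroup.quotientMulEquivOfEq (normalClosure_eq_self N)),
    fun h => h.of_mulEquiv (QuotientGroup.quotientMulEquivOfEq (normalClosure_eq_self N).symm)⟩

end Toolkit

end Summit.SmoothPoincare4.SmoothPoincare4.Theorems.AgkCor6Sufficiency.Negative

end
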